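import Summits.QuantumAdvantage.QuantumAdvantage.Theorems.SymplecticPurityGraphStateSpectrum
import Summits.QuantumAdvantage.QuantumAdvantage.Theorems.SymplecticPurityDlogGraphFlatOrbitFibre
import Summits.QuantumAdvantage.QuantumAdvantage.Theorems.SymplecticPurityDlogGraphFlatSignedRepGuard
import Summits.QuantumAdvantage.QuantumAdvantage.Theorems.SymplecticPurityDlogGraphFlatWalshRange
import Summits.QuantumAdvantage.QuantumAdvantage.Theorems.SymplecticPurityDlogGraphFlatCongCount
import Summits.QuantumAdvantage.QuantumAdvantage.Theorems.SymplecticPurityDlogGraphFlatFlankA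
import Summits.QuantumAdvantage.QuantumAdvantage.Theorems.SymplecticPurityDlogGraphFlatFlank
import Summits.QuantumAdvantage.QuantumAdvantage.Theorems.SymplecticPurityDlogGraphFlatBandA
import Summits.QuantumAdvantage.QuantumAdvantage.Theorems.SymplecticPurityDlogGraphFlatBandB
import Summits.QuantumAdvantage.QuantumAdvantage.Theorems.SymplecticPurityDlogGraphFlatHolderWeak
import Summits.QuantumAdvantage.QuantumAdvantage.Theorems.SymplecticPurityDlogGraphFlatFDMReduce
import Literature.Combinatorics.Additive.SumProductFp
import Summits.QuantumAdvantage.QuantumAdvantage.Theorems.SymplecticPurityDlogGraphFlatPopularDiff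
import Summits.QuantumAdvantage.QuantumAdvantage.Theorems.SymplecticPurityDlogGraphFlatSpreadOfPD

/-!
# Crux `DlogGraphFlat` (stmt-QuantumAdvantage-10732), line `Sketch` — proof SKELETON

The crux: for BHP-window primes `p` (`2ⁿ − 2^{⌊0.53n⌋} ≤ p < 2ⁿ`), primitive roots `g` and the NAF
guard on `p − 1`, the unnormalised DLOG graph vector `v = Σ_{x<2ⁿ} |x⟩|gˣ mod p⟩` on `n + n` qubits
has `|⟨v|σ_S|v⟩| ≤ 2^{(1−δ)n}` for every Pauli string `S ≠ I`.

Composition (`DlogGraphFlat_of`, sorry-free): `v` is the graph vector of the S-box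
`f : 𝔽₂ⁿ → 𝔽₂ⁿ`, `f x = bits (g^{ofBits x} mod p)` (valid since `gˣ mod p < p < 2ⁿ`), so by the
landed dictionary `GraphStateSpectrum_proof` (item 9840) `|⟨v|σ_S|v⟩| ≤ max D Λ` with
`D` = XOR-differential uniformity and `Λ` = linearity (joint Walsh maximum) of `f`. The crux is
therefore the conjunction of two arithmetic statements about `x ↦ gˣ mod p`, each split once more:

* sector A (differentials `D(a,a') = #{x : f (x ⊕ a) = f x ⊕ a'}`, `a ≠ 0`) — NOW FULLY PROVED:
  `stub_dlogDiffFlank` (landed) — off the band `|a| ≈ |a'| ≈ n/2` the count is elementary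
  (ratio form `f(x⊕a)/f(x) = g^{A−2(x∧a)}`, product form `f(x⊕a)·f(x) = g^{A+2(x∧ā)}`, linear /
  quadratic congruences `stub_dlogCongCount`, fibres of `x ↦ gˣ` `stub_dlogOrbitFibre`, and the
  NAF guard `stub_dlogSignedRepGuard` for the multiplier classes `h = ±1`);
  `stub_dlogDiffBand` — the band, DERIVED from `stub_dlogBandCount` (triple count) and
  `stub_dlogBandReduction` applied to R4 = `stub_dlogSpreadEnergy` (a power saving in the
  multiplicative energy of translates of the signed-digit spread set `S_b`), itself DERIVED
  UNCONDITIONALLY (skeleton v8, 2026-08-16) from the landed elementary 𝔽_p sum–product chain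
  `stub_dlogGKDichotomy` (Glibichuk–Konyagin dichotomy) → `stub_dlogSumProductOfGK`
  (`|A| ≤ C K^{e}`, Garaev's scheme) → `stub_dlogPopularDiff` (sets with small product set have no
  popular differences; BSG + Plünnecke–Ruzsa) → `stub_dlogSpreadOfPD` (expansion against sub-cubes).
  The earlier conditional route through the Stevens–de Zeeuw incidence bound (`stub_dlogSpreadOfSdZ`,
  named fact `stevensDeZeeuw_thm4`) is no longer used.
* sector B (Walsh sums `W(α,β) = Σ_x (−1)^{α·x + β·f(x)}`, `β ≠ 0`):
  `stub_dlogWalshRange` (landed) — `α = 0` is the range bias of the `y`-register (`≤ 2·2^{0.53n} + 2`);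
  `stub_dlogWalshTwisted` — `α ≠ 0`, DERIVED by Hölder/Burgess amplification over a digit block of
  the exponent (`stub_dlogWalshHolder`, landed) from the ONE REMAINING OPEN STUB
  `stub_dlogFourthDilationMoment` (FDM: fourth dilation moment of one digital function along
  geometric progressions — the crux's open research core; heavy digit masks against digits of the
  discrete logarithm; contains the Legendre × Walsh sums of `XorDarkCharacters.CharWalshFlat`).

Sorries (v9) live only in the sector-B stubs `stub_dlogDilationDecay` (P1, open), `stub_dlogQuadDilationSum` (Q, open), `stub_dlogPairOfDecay`, `stub_dlogGlueDCB` (provable). Inputs used from the crux's disprover (evidence notes of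
`Disproof.lean`, cdisprove 2026-08-15): `corr_le_card_differential` / `indVec_corr_pauliString`
(= the dictionary step here), `dlogGraphFlat_false_without_guard` (the guard is consumed exactly at
the `h = ±1` multiplier classes of `stub_dlogDiffFlank`), `_without_window` (consumed by
`stub_dlogWalshRange` and the `2ⁿ ≤ 2(p−1)` fibre bound), `_without_primitivity` (fibres ≤ 2).
-/

set_option linter.dupNamespace false -- D-0017: single-problem summit ⇒ `QuantumAdvantage.QuantumAdvantage` by design

namespace Summit.QuantumAdvantage.QuantumAdvantage.Theorems.SymplecticPurity

open Finset Literature.Computability.QuantumComplexity Literature.Computability.Cryptography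
open scoped Pointwise

/-! ### Registered stubs -/

-- LANDED (imported above): `stub_dlogOrbitFibre` (p86015, …DlogGraphFlatOrbitFibre),
-- `stub_dlogSignedRepGuard` (p86095, …DlogGraphFlatSignedRepGuard), `stub_dlogWalshRange` (p86190,
-- …DlogGraphFlatWalshRange), `stub_dlogCongCount` (p86592, …DlogGraphFlatCongCount).


/-- Sector A′ = R4 (formerly the registered open stub `stub_dlogSpreadEnergy`, then derived from
Stevens–de Zeeuw; now DERIVED UNCONDITIONALLY from the 𝔽_p sum–product theorem (seat c1's Literature
`exists_sum_product_constants`, SumProductFp.lean; this seat's Theorems-side twin is `stub_dlogSumProductOfGK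
stub_dlogGKDichotomy`, p98401/p97403), S2 `stub_dlogPopularDiff` (p99391) and S3 `stub_dlogSpreadOfPD` (p98517). -/
theorem stub_dlogSpreadEnergy : ∃ κ : ℝ, 0 < κ ∧ ∃ C : ℝ, 0 < C ∧ ∀ (n p : ℕ), p.Prime →
    2 ^ n ≤ 2 * p → ∀ b : QReg n, 2 * (Finset.univ.filter fun j => b j = true).card ≤ n →
    ∀ c : ZMod p,
    (((((Finset.univ.image fun u : QReg n => fun j => u j && b j) ×ˢ
          (Finset.univ.image fun u : QReg n => fun j => u j && b j)) ×ˢ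
        ((Finset.univ.image fun u : QReg n => fun j => u j && b j) ×ˢ
          (Finset.univ.image fun u : QReg n => fun j => u j && b j))).filter fun q =>
        (c + ((Nat.ofBits b : ZMod p) - 2 * (Nat.ofBits q.1.1 : ZMod p))) *
          (c + ((Nat.ofBits b : ZMod p) - 2 * (Nat.ofBits q.2.2 : ZMod p))) =
        (c + ((Nat.ofBits b : ZMod p) - 2 * (Nat.ofBits q.1.2 : ZMod p))) *
          (c + ((Nat.ofBits b : ZMod p) - 2 * (Nat.ofBits q.2.1 : ZMod p)))).card : ℝ)
      ≤ C * (2 : ℝ) ^ ((3 - κ) * ((Finset.univ.filter fun j => b j = true).card : ℝ)) :=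
  stub_dlogSpreadOfPD (stub_dlogPopularDiff Literature.Combinatorics.Additive.exists_sum_product_constants)


/-- **Sector A, band** (former stub `stub_dlogDiffBand`, now derived): in the band
`m(a) + m(a') + 3 ≥ n − ⌊n/16⌋` the XOR-differential count of `x ↦ gˣ mod p` saves a fixed power,
`D(a,a') ≤ 2^{(1−δ)n}` eventually — from R4 (`stub_dlogSpreadEnergy`) by `stub_dlogBandReduction`. -/
theorem stub_dlogDiffBand : ∃ δ : ℝ, 0 < δ ∧ ∃ n₀ : ℕ, ∀ n ≥ n₀, ∀ p g : ℕ, p.Prime → p < 2 ^ n →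
    2 ^ n ≤ p + 2 ^ (53 * n / 100) → orderOf (g : ZMod p) = p - 1 →
    (∀ c : Fin (n + 1) → ℤ, (∀ i, c i = 0 ∨ c i = 1 ∨ c i = -1) →
      ∑ i, c i * 2 ^ (i : ℕ) = (p : ℤ) - 1 → n ≤ 8 * (Finset.univ.filter fun i => c i ≠ 0).card) →
    ∀ a : QReg n, a ≠ (fun _ => false) → ∀ a' : QReg n,
    n - n / 16 ≤ min (Finset.univ.filter fun i => a i = true).card
          (n - (Finset.univ.filter fun i => a i = true).card) +
        min (Finset.univ.filter fun j => a' j = true).card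
          (n - (Finset.univ.filter fun j => a' j = true).card) + 3 →
    ((Finset.univ.filter fun x : QReg n =>
        (fun i : Fin n => Bool.xor ((g ^ Nat.ofBits (fun j => Bool.xor (x j) (a j)) % p).testBit (i : ℕ))
          ((g ^ Nat.ofBits x % p).testBit (i : ℕ))) = a').card : ℝ)
      ≤ (2 : ℝ) ^ ((1 - δ) * (n : ℝ)) :=
  stub_dlogBandReduction stub_dlogSpreadEnergy

/-! ### Sector B stubs (skeleton v9): DCB (the sign-free non-paired fourth dilation sum of seat c1's
reduction, `stub_dlogFDMweakOfDCB` p-landed in …FDMReduce.lean, consumed by `stub_dlogWalshHolderWeak`,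
…HolderWeak.lean) split on the low digit block into its PAIR part (reduced to a g-free height-decay statement)
and its genuinely FOURFOLD part. -/

/-- **Stub P1 (sector B, OPEN, g-free): height decay of the pair dilation correlations of a digital
function.** For every window prime `p`, mask `β ≠ 0` and `r ∈ 𝔽_pˣ` there is a representation
`b·r = a` (`a ∈ ℤ`, `b ≥ 1`) with `|Σ_λ F_β(λ)F_β(rλ)| ≤ C p (max(|a|,b)^(−c') + p^(−η₀))`,
`F_β(y) = (−1)^(β·bits(y.val))`. Resonances live at small height only (parity mask `β = e₀`:
`S(a) = 1/a`, top bit: `S(3) ≈ 1/3`, Thue–Morse mask: `S(2^d) ≈ 2^(−d)`); generic `r` must show a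
power saving (the research content; cf. Cruxes/DlogGraphFlat/NOTES.md §8.1). -/
theorem stub_dlogDilationDecay :
    ∃ c' : ℝ, 0 < c' ∧ ∃ η₀ : ℝ, 0 < η₀ ∧ ∃ C : ℝ, 0 < C ∧ ∃ n₀ : ℕ, ∀ n ≥ n₀,
      ∀ (p : ℕ) [Fact (Nat.Prime p)], p < 2 ^ n → 2 ^ n ≤ p + 2 ^ (53 * n / 100) →
      ∀ β : QReg n, β ≠ (fun _ => false) → ∀ r : ZMod p, r ≠ 0 →
      ∃ a : ℤ, ∃ b : ℕ, 0 < b ∧ (b : ZMod p) * r = (a : ZMod p) ∧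
        |∑ lam : ZMod p,
          (∏ i : Fin n, (if β i && (lam).val.testBit (i : ℕ) then (-1 : ℝ) else 1)) *
          (∏ i : Fin n, (if β i && (lam * r).val.testBit (i : ℕ) then (-1 : ℝ) else 1))| ≤
        C * (p : ℝ) * ((max (|(a : ℝ)|) (b : ℝ)) ^ (-c') + (p : ℝ) ^ (-η₀)) := by
  sorry

/-- **Stub P2 (sector B, provable from P1): the pair dilation sum along the short geometric
progression** `Σ_(0<h<2^m) |Σ_λ F_β(λ)F_β(λ gʰ)| ≤ C 2^((1−κ₁)m) p` for `m ≤ μ₁ n`. From P1 by trivial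
counting (at most `3(2T+1)T` exponents `h < 2^m` admit a representation of height `≤ T`: distinct
residues as `g` is primitive and `2^m < 2p`), one threshold `T = 2^(m/(2+c'))`, and `2^m p^(1−η₀) ≤
2^((1−κ₁)m) p` for `m ≤ μ₁ n`, `μ₁ = η₀/(2κ₁)`, `κ₁ = c'/(2+c')`. -/
theorem stub_dlogPairOfDecay :
    (∃ c' : ℝ, 0 < c' ∧ ∃ η₀ : ℝ, 0 < η₀ ∧ ∃ C : ℝ, 0 < C ∧ ∃ n₀ : ℕ, ∀ n ≥ n₀,
      ∀ (p : ℕ) [Fact (Nat.Prime p)], p < 2 ^ n → 2 ^ n ≤ p + 2 ^ (53 * n / 100) →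
      ∀ β : QReg n, β ≠ (fun _ => false) → ∀ r : ZMod p, r ≠ 0 →
      ∃ a : ℤ, ∃ b : ℕ, 0 < b ∧ (b : ZMod p) * r = (a : ZMod p) ∧
        |∑ lam : ZMod p,
          (∏ i : Fin n, (if β i && (lam).val.testBit (i : ℕ) then (-1 : ℝ) else 1)) *
          (∏ i : Fin n, (if β i && (lam * r).val.testBit (i : ℕ) then (-1 : ℝ) else 1))| ≤
        C * (p : ℝ) * ((max (|(a : ℝ)|) (b : ℝ)) ^ (-c') + (p : ℝ) ^ (-η₀))) →
    ∃ κ₁ : ℝ, 0 < κ₁ ∧ ∃ μ₁ : ℝ, 0 < μ₁ ∧ ∃ C : ℝ, 0 < C ∧ ∃ n₀ : ℕ, ∀ n ≥ n₀,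
      ∀ (p : ℕ) [Fact (Nat.Prime p)] (g : ℕ), p < 2 ^ n → 2 ^ n ≤ p + 2 ^ (53 * n / 100) →
      orderOf (g : ZMod p) = p - 1 →
      ∀ β : QReg n, β ≠ (fun _ => false) → ∀ m : ℕ, (m : ℝ) ≤ μ₁ * (n : ℝ) →
      ∑ h ∈ Finset.Ico 1 (2 ^ m),
        |∑ lam : ZMod p,
          (∏ i : Fin n, (if β i && (lam).val.testBit (i : ℕ) then (-1 : ℝ) else 1)) *
          (∏ i : Fin n, (if β i && (lam * (g : ZMod p) ^ h).val.testBit (i : ℕ) then (-1 : ℝ) else 1))| ≤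
        C * (2 : ℝ) ^ ((1 - κ₁) * (m : ℝ)) * (p : ℝ) := by
  sorry

/-- Pair dilation sum (DERIVED: P1 + P2). -/
theorem stub_dlogPairDilationSum :
    ∃ κ₁ : ℝ, 0 < κ₁ ∧ ∃ μ₁ : ℝ, 0 < μ₁ ∧ ∃ C : ℝ, 0 < C ∧ ∃ n₀ : ℕ, ∀ n ≥ n₀,
      ∀ (p : ℕ) [Fact (Nat.Prime p)] (g : ℕ), p < 2 ^ n → 2 ^ n ≤ p + 2 ^ (53 * n / 100) →
      orderOf (g : ZMod p) = p - 1 →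
      ∀ β : QReg n, β ≠ (fun _ => false) → ∀ m : ℕ, (m : ℝ) ≤ μ₁ * (n : ℝ) →
      ∑ h ∈ Finset.Ico 1 (2 ^ m),
        |∑ lam : ZMod p,
          (∏ i : Fin n, (if β i && (lam).val.testBit (i : ℕ) then (-1 : ℝ) else 1)) *
          (∏ i : Fin n, (if β i && (lam * (g : ZMod p) ^ h).val.testBit (i : ℕ) then (-1 : ℝ) else 1))| ≤
        C * (2 : ℝ) ^ ((1 - κ₁) * (m : ℝ)) * (p : ℝ) :=
  stub_dlogPairOfDecay stub_dlogDilationDecay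

/-- **Stub Q (sector B, OPEN): the genuinely fourfold dilation correlations along the short geometric
progression, sign-free.** For block lengths `m ≤ μ₂ n`, the sum over 4-tuples of PAIRWISE DISTINCT low
patterns of `|Σ_λ Π_i F_β(λ g^(uᵢ))|` is `≤ C 2^((3−κ₂)m) p` (generic tuples are `≈ √p` each, so for
`2^m ≤ p^(1/2−ε)` this asks for any power saving over the trivial `2^(4m)·p` beyond what the `O(4^m)`
near-diagonal resonances cost, e.g. `(u, u+1, u+2, u+3)` for `g = 2`, `β = 1ⁿ`). -/
theorem stub_dlogQuadDilationSum :
    ∃ κ₂ : ℝ, 0 < κ₂ ∧ ∃ μ₂ : ℝ, 0 < μ₂ ∧ ∃ C : ℝ, 0 < C ∧ ∃ n₀ : ℕ, ∀ n ≥ n₀,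
      ∀ (p : ℕ) [Fact (Nat.Prime p)] (g : ℕ), p < 2 ^ n → 2 ^ n ≤ p + 2 ^ (53 * n / 100) →
      orderOf (g : ZMod p) = p - 1 →
      (∀ c : Fin (n + 1) → ℤ, (∀ i, c i = 0 ∨ c i = 1 ∨ c i = -1) →
        ∑ i, c i * 2 ^ (i : ℕ) = (p : ℤ) - 1 → n ≤ 8 * (Finset.univ.filter fun i => c i ≠ 0).card) →
      ∀ β : QReg n, β ≠ (fun _ => false) → ∀ m : ℕ, (m : ℝ) ≤ μ₂ * (n : ℝ) →
      ∑ q ∈ (((Finset.univ.filter fun u : QReg n => ∀ j : Fin n, m ≤ (j : ℕ) → u j = false) ×ˢ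
            (Finset.univ.filter fun u : QReg n => ∀ j : Fin n, m ≤ (j : ℕ) → u j = false)) ×ˢ
           ((Finset.univ.filter fun u : QReg n => ∀ j : Fin n, m ≤ (j : ℕ) → u j = false) ×ˢ
            (Finset.univ.filter fun u : QReg n => ∀ j : Fin n, m ≤ (j : ℕ) → u j = false))).filter
            (fun q => q.1.1 ≠ q.1.2 ∧ q.1.1 ≠ q.2.1 ∧ q.1.1 ≠ q.2.2 ∧ q.1.2 ≠ q.2.1 ∧
              q.1.2 ≠ q.2.2 ∧ q.2.1 ≠ q.2.2),
        |∑ lam : ZMod p,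
          (∏ i : Fin n, (if β i && (lam * (g : ZMod p) ^ Nat.ofBits q.1.1).val.testBit (i : ℕ) then (-1 : ℝ) else 1)) *
          (∏ i : Fin n, (if β i && (lam * (g : ZMod p) ^ Nat.ofBits q.1.2).val.testBit (i : ℕ) then (-1 : ℝ) else 1)) *
          ((∏ i : Fin n, (if β i && (lam * (g : ZMod p) ^ Nat.ofBits q.2.1).val.testBit (i : ℕ) then (-1 : ℝ) else 1)) *
          (∏ i : Fin n, (if β i && (lam * (g : ZMod p) ^ Nat.ofBits q.2.2).val.testBit (i : ℕ) then (-1 : ℝ) else 1)))| ≤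
        C * (2 : ℝ) ^ ((3 - κ₂) * (m : ℝ)) * (p : ℝ) := by
  sorry

/-- **Stub G (sector B, provable — pure algebra + bookkeeping): DCB from its pair and fourfold parts.**
With `D = {j < m}`, `m = min n ⌊min(μ₁,μ₂) n⌋`: a non-paired 4-tuple either has a coincidence
`uᵢ = uⱼ` with the other two entries distinct — then `F² = 1` and its correlation is
`|Σ_λ F_β(λ)F_β(λ g^|Δ|)|`, `0 < |Δ| < 2^m` (substitute `λ ↦ λ g^(−min)`, `g` a unit), at most `12·4^m`
such tuples per difference class in total — or is pairwise distinct (stub Q). Hence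
`Σ_(non-paired) |K| ≤ 12·4^m·(pair sum) + (fourfold sum) ≤ (12C₁ + C₂) 2^((3−κ)m) p`, `κ = min κ₁ κ₂`. -/
theorem stub_dlogGlueDCB :
    (∃ κ₁ : ℝ, 0 < κ₁ ∧ ∃ μ₁ : ℝ, 0 < μ₁ ∧ ∃ C : ℝ, 0 < C ∧ ∃ n₀ : ℕ, ∀ n ≥ n₀,
      ∀ (p : ℕ) [Fact (Nat.Prime p)] (g : ℕ), p < 2 ^ n → 2 ^ n ≤ p + 2 ^ (53 * n / 100) →
      orderOf (g : ZMod p) = p - 1 →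
      ∀ β : QReg n, β ≠ (fun _ => false) → ∀ m : ℕ, (m : ℝ) ≤ μ₁ * (n : ℝ) →
      ∑ h ∈ Finset.Ico 1 (2 ^ m),
        |∑ lam : ZMod p,
          (∏ i : Fin n, (if β i && (lam).val.testBit (i : ℕ) then (-1 : ℝ) else 1)) *
          (∏ i : Fin n, (if β i && (lam * (g : ZMod p) ^ h).val.testBit (i : ℕ) then (-1 : ℝ) else 1))| ≤
        C * (2 : ℝ) ^ ((1 - κ₁) * (m : ℝ)) * (p : ℝ)) →
    (∃ κ₂ : ℝ, 0 < κ₂ ∧ ∃ μ₂ : ℝ, 0 < μ₂ ∧ ∃ C : ℝ, 0 < C ∧ ∃ n₀ : ℕ, ∀ n ≥ n₀,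
      ∀ (p : ℕ) [Fact (Nat.Prime p)] (g : ℕ), p < 2 ^ n → 2 ^ n ≤ p + 2 ^ (53 * n / 100) →
      orderOf (g : ZMod p) = p - 1 →
      (∀ c : Fin (n + 1) → ℤ, (∀ i, c i = 0 ∨ c i = 1 ∨ c i = -1) →
        ∑ i, c i * 2 ^ (i : ℕ) = (p : ℤ) - 1 → n ≤ 8 * (Finset.univ.filter fun i => c i ≠ 0).card) →
      ∀ β : QReg n, β ≠ (fun _ => false) → ∀ m : ℕ, (m : ℝ) ≤ μ₂ * (n : ℝ) →
      ∑ q ∈ (((Finset.univ.filter fun u : QReg n => ∀ j : Fin n, m ≤ (j : ℕ) → u j = false) ×ˢ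
            (Finset.univ.filter fun u : QReg n => ∀ j : Fin n, m ≤ (j : ℕ) → u j = false)) ×ˢ
           ((Finset.univ.filter fun u : QReg n => ∀ j : Fin n, m ≤ (j : ℕ) → u j = false) ×ˢ
            (Finset.univ.filter fun u : QReg n => ∀ j : Fin n, m ≤ (j : ℕ) → u j = false))).filter
            (fun q => q.1.1 ≠ q.1.2 ∧ q.1.1 ≠ q.2.1 ∧ q.1.1 ≠ q.2.2 ∧ q.1.2 ≠ q.2.1 ∧
              q.1.2 ≠ q.2.2 ∧ q.2.1 ≠ q.2.2),
        |∑ lam : ZMod p,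
          (∏ i : Fin n, (if β i && (lam * (g : ZMod p) ^ Nat.ofBits q.1.1).val.testBit (i : ℕ) then (-1 : ℝ) else 1)) *
          (∏ i : Fin n, (if β i && (lam * (g : ZMod p) ^ Nat.ofBits q.1.2).val.testBit (i : ℕ) then (-1 : ℝ) else 1)) *
          ((∏ i : Fin n, (if β i && (lam * (g : ZMod p) ^ Nat.ofBits q.2.1).val.testBit (i : ℕ) then (-1 : ℝ) else 1)) *
          (∏ i : Fin n, (if β i && (lam * (g : ZMod p) ^ Nat.ofBits q.2.2).val.testBit (i : ℕ) then (-1 : ℝ) else 1)))| ≤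
        C * (2 : ℝ) ^ ((3 - κ₂) * (m : ℝ)) * (p : ℝ)) →
    ∃ κ : ℝ, 0 < κ ∧ ∃ μ : ℝ, 0 < μ ∧ ∃ C : ℝ, 0 < C ∧ ∃ n₀ : ℕ, ∀ n ≥ n₀,
      ∀ (p : ℕ) [Fact (Nat.Prime p)] (g : ℕ), p < 2 ^ n → 2 ^ n ≤ p + 2 ^ (53 * n / 100) →
      orderOf (g : ZMod p) = p - 1 →
      (∀ c : Fin (n + 1) → ℤ, (∀ i, c i = 0 ∨ c i = 1 ∨ c i = -1) →
        ∑ i, c i * 2 ^ (i : ℕ) = (p : ℤ) - 1 → n ≤ 8 * (Finset.univ.filter fun i => c i ≠ 0).card) →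
      ∀ β : QReg n, β ≠ (fun _ => false) →
      ∃ D : QReg n, μ * (n : ℝ) ≤ ((Finset.univ.filter fun j => D j = true).card : ℝ) ∧
      ∑ q ∈ (((Finset.univ.filter fun u : QReg n => ∀ j : Fin n, D j = false → u j = false) ×ˢ
              (Finset.univ.filter fun u : QReg n => ∀ j : Fin n, D j = false → u j = false)) ×ˢ
            ((Finset.univ.filter fun u : QReg n => ∀ j : Fin n, D j = false → u j = false) ×ˢ
              (Finset.univ.filter fun u : QReg n => ∀ j : Fin n, D j = false → u j = false))).filter
          fun q => ¬ ((q.1.1 = q.1.2 ∧ q.2.1 = q.2.2) ∨ (q.1.1 = q.2.1 ∧ q.1.2 = q.2.2) ∨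
            (q.1.1 = q.2.2 ∧ q.1.2 = q.2.1)),
        |∑ lam : ZMod p,
          (∏ i : Fin n, (if β i && (lam * (g : ZMod p) ^ Nat.ofBits q.1.1).val.testBit (i : ℕ)
            then (-1 : ℝ) else 1)) *
          (∏ i : Fin n, (if β i && (lam * (g : ZMod p) ^ Nat.ofBits q.1.2).val.testBit (i : ℕ)
            then (-1 : ℝ) else 1)) *
          ((∏ i : Fin n, (if β i && (lam * (g : ZMod p) ^ Nat.ofBits q.2.1).val.testBit (i : ℕ)
            then (-1 : ℝ) else 1)) *
          (∏ i : Fin n, (if β i && (lam * (g : ZMod p) ^ Nat.ofBits q.2.2).val.testBit (i : ℕ)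
            then (-1 : ℝ) else 1)))| ≤
        C * (2 : ℝ) ^ ((3 - κ) * ((Finset.univ.filter fun j => D j = true).card : ℝ)) * p := by
  sorry

/-- DCB — seat c1's sign-free non-paired dilation-correlation bound (DERIVED: G + P1/P2 + Q). -/
theorem dcb_of_pair_quad :
    ∃ κ : ℝ, 0 < κ ∧ ∃ μ : ℝ, 0 < μ ∧ ∃ C : ℝ, 0 < C ∧ ∃ n₀ : ℕ, ∀ n ≥ n₀,
      ∀ (p : ℕ) [Fact (Nat.Prime p)] (g : ℕ), p < 2 ^ n → 2 ^ n ≤ p + 2 ^ (53 * n / 100) →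
      orderOf (g : ZMod p) = p - 1 →
      (∀ c : Fin (n + 1) → ℤ, (∀ i, c i = 0 ∨ c i = 1 ∨ c i = -1) →
        ∑ i, c i * 2 ^ (i : ℕ) = (p : ℤ) - 1 → n ≤ 8 * (Finset.univ.filter fun i => c i ≠ 0).card) →
      ∀ β : QReg n, β ≠ (fun _ => false) →
      ∃ D : QReg n, μ * (n : ℝ) ≤ ((Finset.univ.filter fun j => D j = true).card : ℝ) ∧
      ∑ q ∈ (((Finset.univ.filter fun u : QReg n => ∀ j : Fin n, D j = false → u j = false) ×ˢ
              (Finset.univ.filter fun u : QReg n => ∀ j : Fin n, D j = false → u j = false)) ×ˢ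
            ((Finset.univ.filter fun u : QReg n => ∀ j : Fin n, D j = false → u j = false) ×ˢ
              (Finset.univ.filter fun u : QReg n => ∀ j : Fin n, D j = false → u j = false))).filter
          fun q => ¬ ((q.1.1 = q.1.2 ∧ q.2.1 = q.2.2) ∨ (q.1.1 = q.2.1 ∧ q.1.2 = q.2.2) ∨
            (q.1.1 = q.2.2 ∧ q.1.2 = q.2.1)),
        |∑ lam : ZMod p,
          (∏ i : Fin n, (if β i && (lam * (g : ZMod p) ^ Nat.ofBits q.1.1).val.testBit (i : ℕ)
            then (-1 : ℝ) else 1)) *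
          (∏ i : Fin n, (if β i && (lam * (g : ZMod p) ^ Nat.ofBits q.1.2).val.testBit (i : ℕ)
            then (-1 : ℝ) else 1)) *
          ((∏ i : Fin n, (if β i && (lam * (g : ZMod p) ^ Nat.ofBits q.2.1).val.testBit (i : ℕ)
            then (-1 : ℝ) else 1)) *
          (∏ i : Fin n, (if β i && (lam * (g : ZMod p) ^ Nat.ofBits q.2.2).val.testBit (i : ℕ)
            then (-1 : ℝ) else 1)))| ≤
        C * (2 : ℝ) ^ ((3 - κ) * ((Finset.univ.filter fun j => D j = true).card : ℝ)) * p :=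
  stub_dlogGlueDCB stub_dlogPairDilationSum stub_dlogQuadDilationSum


/-! ### Composition (sorry-free) -/

/-- The DLOG S-box on `n`-bit registers read through `Nat.ofBits`: the crux's indicator vector is
the graph vector of `x ↦ bits (g^{ofBits x} mod p)` because `gˣ mod p < p < 2ⁿ`. -/
theorem dlog_indicator_eq_graph (n p g : ℕ) (hp0 : 0 < p) (hpn : p < 2 ^ n) :
    (fun w : QReg (n + n) =>
      if Nat.ofBits (fun j : Fin n => w (Fin.natAdd n j)) =
          g ^ Nat.ofBits (fun i : Fin n => w (Fin.castAdd n i)) % p then (1 : ℂ) else 0) =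
    fun w : QReg (n + n) =>
      if (fun j : Fin n => w (Fin.natAdd n j)) =
          (fun x : QReg n => fun j : Fin n => (g ^ Nat.ofBits x % p).testBit (j : ℕ))
            (fun i : Fin n => w (Fin.castAdd n i)) then (1 : ℂ) else 0 := by
  funext w
  have key : (Nat.ofBits (fun j : Fin n => w (Fin.natAdd n j)) =
        g ^ Nat.ofBits (fun i : Fin n => w (Fin.castAdd n i)) % p) ↔
      ((fun j : Fin n => w (Fin.natAdd n j)) =
        fun j : Fin n => (g ^ Nat.ofBits (fun i : Fin n => w (Fin.castAdd n i)) % p).testBit (j : ℕ)) := by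
    set m := g ^ Nat.ofBits (fun i : Fin n => w (Fin.castAdd n i)) % p with hm
    have hm2 : m < 2 ^ n := (Nat.mod_lt _ hp0).trans hpn
    constructor
    · intro h
      funext j
      have := Nat.testBit_ofBits_lt (fun j : Fin n => w (Fin.natAdd n j)) j.val j.isLt
      rw [h] at this
      simpa using this.symm
    · intro h
      rw [h, Nat.ofBits_testBit, Nat.mod_eq_of_lt hm2]
  by_cases hc : Nat.ofBits (fun j : Fin n => w (Fin.natAdd n j)) =
      g ^ Nat.ofBits (fun i : Fin n => w (Fin.castAdd n i)) % p
  · rw [if_pos hc, if_pos (key.mp hc)]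
  · rw [if_neg hc, if_neg (fun h => hc (key.mpr h))]

/-- Numerical bookkeeping for the flank: for `128 ≤ n` and `0 < δ ≤ 1/64`,
`2^{n − ⌊n/16⌋ + 2} + 2^{n − ⌊n/8⌋ + 2} ≤ 2^{(1−δ)n}`. -/
theorem flank_numerics (n : ℕ) (hn : 128 ≤ n) (δ : ℝ) (hδ : δ ≤ 1 / 64) :
    ((2 ^ (n - n / 16 + 2) + 2 ^ (n - n / 8 + 2) : ℕ) : ℝ) ≤ (2 : ℝ) ^ ((1 - δ) * (n : ℝ)) := by
  -- both terms are ≤ 2^{n - n/16 + 2}, and n - n/16 + 3 ≤ (1 - δ) n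
  have h16 : n / 8 ≥ n / 16 := Nat.div_le_div_left (by norm_num) (by norm_num)
  have hA : (2 : ℕ) ^ (n - n / 8 + 2) ≤ 2 ^ (n - n / 16 + 2) :=
    Nat.pow_le_pow_right (by norm_num) (by omega)
  have hsum : ((2 ^ (n - n / 16 + 2) + 2 ^ (n - n / 8 + 2) : ℕ) : ℝ) ≤ (2 : ℝ) ^ ((n - n / 16 + 3 : ℕ) : ℝ) := by
    rw [Real.rpow_natCast]
    have : (2 : ℕ) ^ (n - n / 16 + 2) + 2 ^ (n - n / 8 + 2) ≤ 2 ^ (n - n / 16 + 3) := by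
      calc (2 : ℕ) ^ (n - n / 16 + 2) + 2 ^ (n - n / 8 + 2)
          ≤ 2 ^ (n - n / 16 + 2) + 2 ^ (n - n / 16 + 2) := Nat.add_le_add_left hA _
        _ = 2 ^ (n - n / 16 + 3) := by ring
    exact_mod_cast this
  refine hsum.trans (Real.rpow_le_rpow_of_exponent_le (by norm_num) ?_)
  -- (n - n/16 + 3 : ℕ) ≤ (1 - δ) * n as reals
  have hdiv : (16 : ℕ) * (n / 16) + 16 > n := by omega
  have hle : n / 16 ≤ n := Nat.div_le_self _ _
  have hcast : ((n - n / 16 + 3 : ℕ) : ℝ) = (n : ℝ) - ((n / 16 : ℕ) : ℝ) + 3 := by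
    rw [Nat.cast_add, Nat.cast_sub hle]
    norm_num
  rw [hcast]
  have h1 : (16 : ℝ) * ((n / 16 : ℕ) : ℝ) + 16 > (n : ℝ) := by exact_mod_cast hdiv
  have hn' : (128 : ℝ) ≤ n := by exact_mod_cast hn
  nlinarith

/-- Numerical bookkeeping for the range bias: for `128 ≤ n` and `δ ≤ 1/64`,
`2·2^{⌊53n/100⌋} + 2 ≤ 2^{(1−δ)n}`. -/
theorem range_numerics (n : ℕ) (hn : 128 ≤ n) (δ : ℝ) (hδ : δ ≤ 1 / 64) :
    (2 : ℝ) * 2 ^ (53 * n / 100) + 2 ≤ (2 : ℝ) ^ ((1 - δ) * (n : ℝ)) := by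
  have hsum : (2 : ℝ) * 2 ^ (53 * n / 100) + 2 ≤ (2 : ℝ) ^ ((53 * n / 100 + 2 : ℕ) : ℝ) := by
    rw [Real.rpow_natCast]
    have h1 : (1 : ℝ) ≤ 2 ^ (53 * n / 100) := one_le_pow₀ (by norm_num)
    have : (2 : ℝ) ^ (53 * n / 100 + 2) = 4 * 2 ^ (53 * n / 100) := by ring
    rw [this]
    linarith
  refine hsum.trans (Real.rpow_le_rpow_of_exponent_le (by norm_num) ?_)
  have hdiv : (100 : ℕ) * (53 * n / 100) ≤ 53 * n := Nat.mul_div_le _ _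
  have h1 : (100 : ℝ) * ((53 * n / 100 : ℕ) : ℝ) ≤ 53 * (n : ℝ) := by exact_mod_cast hdiv
  have hn' : (128 : ℝ) ≤ n := by exact_mod_cast hn
  push_cast
  nlinarith

/-- **Sector A of the crux, unconditional: XOR-differential uniformity of the DLOG S-box.**
There are `δ > 0` and `n₀` such that for all `n ≥ n₀`, every BHP-window prime `p < 2ⁿ`
(`2ⁿ ≤ p + 2^{⌊53n/100⌋}`), every primitive root `g` and under the NAF guard on `p − 1`, every
non-zero input difference `a` and every output difference `a'` satisfy
`#{x ∈ 𝔽₂ⁿ : bits(g^{x⊕a} mod p) = bits(gˣ mod p) ⊕ a'} ≤ 2^{(1−δ)n}`.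
Flank (`stub_dlogDiffFlank`) + band (`stub_dlogDiffBand`, from the sum–product chain). -/
theorem dlog_xorDifferential_flat : ∃ δ : ℝ, 0 < δ ∧ ∃ n₀ : ℕ, ∀ n ≥ n₀, ∀ p g : ℕ, p.Prime →
    p < 2 ^ n → 2 ^ n ≤ p + 2 ^ (53 * n / 100) → orderOf (g : ZMod p) = p - 1 →
    (∀ c : Fin (n + 1) → ℤ, (∀ i, c i = 0 ∨ c i = 1 ∨ c i = -1) →
      ∑ i, c i * 2 ^ (i : ℕ) = (p : ℤ) - 1 → n ≤ 8 * (Finset.univ.filter fun i => c i ≠ 0).card) →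
    ∀ a : QReg n, a ≠ (fun _ => false) → ∀ a' : QReg n,
    ((Finset.univ.filter fun x : QReg n =>
        (fun i : Fin n => Bool.xor ((g ^ Nat.ofBits (fun j => Bool.xor (x j) (a j)) % p).testBit (i : ℕ))
          ((g ^ Nat.ofBits x % p).testBit (i : ℕ))) = a').card : ℝ)
      ≤ (2 : ℝ) ^ ((1 - δ) * (n : ℝ)) := by
  obtain ⟨δB, hδB, nB, hB⟩ := stub_dlogDiffBand
  set δ : ℝ := min δB (1 / 64) with hδdef
  have hδpos : 0 < δ := lt_min hδB (by norm_num)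
  have hδB' : δ ≤ δB := min_le_left _ _
  have hδ64 : δ ≤ 1 / 64 := min_le_right _ _
  have hmono : ∀ {δ₁ δ₂ : ℝ} (n : ℕ), δ₂ ≤ δ₁ →
      (2 : ℝ) ^ ((1 - δ₁) * (n : ℝ)) ≤ (2 : ℝ) ^ ((1 - δ₂) * (n : ℝ)) := by
    intro δ₁ δ₂ n h
    refine Real.rpow_le_rpow_of_exponent_le (by norm_num) ?_
    exact mul_le_mul_of_nonneg_right (by linarith) (Nat.cast_nonneg _)
  refine ⟨δ, hδpos, max nB 128, ?_⟩
  intro n hn p g hp hpn hwin hg hguard a ha b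
  have hnB : nB ≤ n := le_trans (le_max_left _ _) hn
  have hn128 : 128 ≤ n := le_trans (le_max_right _ _) hn
  set f : QReg n → QReg n := fun x => fun j : Fin n => (g ^ Nat.ofBits x % p).testBit (j : ℕ) with hf
  change ((Finset.univ.filter fun x : QReg n =>
      (fun i => Bool.xor (f (fun j => Bool.xor (x j) (a j)) i) (f x i)) = b).card : ℝ) ≤ _
  by_cases hband : n - n / 16 ≤
      min (Finset.univ.filter fun i => a i = true).card
          (n - (Finset.univ.filter fun i => a i = true).card) +
        min (Finset.univ.filter fun j => b j = true).card
          (n - (Finset.univ.filter fun j => b j = true).card) + 3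
  · exact (hB n hnB p g hp hpn hwin hg hguard a ha b hband).trans (hmono n hδB')
  · have hflank := stub_dlogDiffFlank n p g hp hpn hwin hg hguard (by omega) a ha b
    push Not at hband
    have hexp : min (Finset.univ.filter fun i => a i = true).card
          (n - (Finset.univ.filter fun i => a i = true).card) +
        min (Finset.univ.filter fun j => b j = true).card
          (n - (Finset.univ.filter fun j => b j = true).card) + 3 ≤ n - n / 16 + 2 := by omega
    have hnat : (Finset.univ.filter fun x : QReg n =>
        (fun i => Bool.xor (f (fun j => Bool.xor (x j) (a j)) i) (f x i)) = b).card
          ≤ 2 ^ (n - n / 16 + 2) + 2 ^ (n - n / 8 + 2) :=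
      hflank.trans (Nat.add_le_add_right (Nat.pow_le_pow_right (by norm_num) hexp) _)
    have hreal : ((Finset.univ.filter fun x : QReg n =>
        (fun i => Bool.xor (f (fun j => Bool.xor (x j) (a j)) i) (f x i)) = b).card : ℝ)
          ≤ ((2 ^ (n - n / 16 + 2) + 2 ^ (n - n / 8 + 2) : ℕ) : ℝ) := by exact_mod_cast hnat
    exact hreal.trans (flank_numerics n hn128 δ hδ64)

/-- **The crux modulo DCB (line `Sketch`, composition)**: seat c1's sign-free non-paired
dilation-correlation bound DCB (the hypothesis of the landed `stub_dlogFDMweakOfDCB`, …FDMReduce.lean)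
implies the crux `DlogGraphFlat` — sector A unconditionally (`dlog_xorDifferential_flat`), sector B from
the range bias (`stub_dlogWalshRange`) and the weak Hölder amplification
(`stub_dlogWalshHolderWeak (stub_dlogFDMweakOfDCB hDCB)`, …HolderWeak.lean), assembled through the S-box
dictionary `GraphStateSpectrum_proof`. In the skeleton, `DlogGraphFlat_of := dlogGraphFlat_of_dcb dcb_of_pair_quad`. -/
theorem dlogGraphFlat_of_dcb (hDCB : ∃ κ : ℝ, 0 < κ ∧ ∃ μ : ℝ, 0 < μ ∧ ∃ C : ℝ, 0 < C ∧ ∃ n₀ : ℕ, ∀ n ≥ n₀,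
        ∀ (p : ℕ) [Fact (Nat.Prime p)] (g : ℕ), p < 2 ^ n → 2 ^ n ≤ p + 2 ^ (53 * n / 100) →
        orderOf (g : ZMod p) = p - 1 →
        (∀ c : Fin (n + 1) → ℤ, (∀ i, c i = 0 ∨ c i = 1 ∨ c i = -1) →
          ∑ i, c i * 2 ^ (i : ℕ) = (p : ℤ) - 1 → n ≤ 8 * (Finset.univ.filter fun i => c i ≠ 0).card) →
        ∀ β : QReg n, β ≠ (fun _ => false) →
        ∃ D : QReg n, μ * (n : ℝ) ≤ ((Finset.univ.filter fun j => D j = true).card : ℝ) ∧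
        ∑ q ∈ (((Finset.univ.filter fun u : QReg n => ∀ j : Fin n, D j = false → u j = false) ×ˢ
                (Finset.univ.filter fun u : QReg n => ∀ j : Fin n, D j = false → u j = false)) ×ˢ
              ((Finset.univ.filter fun u : QReg n => ∀ j : Fin n, D j = false → u j = false) ×ˢ
                (Finset.univ.filter fun u : QReg n => ∀ j : Fin n, D j = false → u j = false))).filter
            fun q => ¬ ((q.1.1 = q.1.2 ∧ q.2.1 = q.2.2) ∨ (q.1.1 = q.2.1 ∧ q.1.2 = q.2.2) ∨
              (q.1.1 = q.2.2 ∧ q.1.2 = q.2.1)),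
          |∑ lam : ZMod p,
            (∏ i : Fin n, (if β i && (lam * (g : ZMod p) ^ Nat.ofBits q.1.1).val.testBit (i : ℕ)
              then (-1 : ℝ) else 1)) *
            (∏ i : Fin n, (if β i && (lam * (g : ZMod p) ^ Nat.ofBits q.1.2).val.testBit (i : ℕ)
              then (-1 : ℝ) else 1)) *
            ((∏ i : Fin n, (if β i && (lam * (g : ZMod p) ^ Nat.ofBits q.2.1).val.testBit (i : ℕ)
              then (-1 : ℝ) else 1)) *
            (∏ i : Fin n, (if β i && (lam * (g : ZMod p) ^ Nat.ofBits q.2.2).val.testBit (i : ℕ)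
              then (-1 : ℝ) else 1)))| ≤
          C * (2 : ℝ) ^ ((3 - κ) * ((Finset.univ.filter fun j => D j = true).card : ℝ)) * p) :
    Summit.QuantumAdvantage.QuantumAdvantage.Theses.SymplecticPurity.DlogGraphFlat := by
  unfold Summit.QuantumAdvantage.QuantumAdvantage.Theses.SymplecticPurity.DlogGraphFlat
  obtain ⟨δB, hδB, nB, hB⟩ := dlog_xorDifferential_flat
  obtain ⟨δT, hδT, nT, hT⟩ := stub_dlogWalshHolderWeak (stub_dlogFDMweakOfDCB hDCB)
  -- the common exponent
  set δ : ℝ := min (min δB δT) (1 / 64) with hδdef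
  have hδpos : 0 < δ := lt_min (lt_min hδB hδT) (by norm_num)
  have hδB' : δ ≤ δB := (min_le_left _ _).trans (min_le_left _ _)
  have hδT' : δ ≤ δT := (min_le_left _ _).trans (min_le_right _ _)
  have hδ64 : δ ≤ 1 / 64 := min_le_right _ _
  have hmono : ∀ {δ₁ δ₂ : ℝ} (n : ℕ), δ₂ ≤ δ₁ →
      (2 : ℝ) ^ ((1 - δ₁) * (n : ℝ)) ≤ (2 : ℝ) ^ ((1 - δ₂) * (n : ℝ)) := by
    intro δ₁ δ₂ n h
    refine Real.rpow_le_rpow_of_exponent_le (by norm_num) ?_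
    exact mul_le_mul_of_nonneg_right (by linarith) (Nat.cast_nonneg _)
  refine ⟨δ, hδpos, max (max nB nT) 128, ?_⟩
  intro n hn p hp hpn hwin g hg hguard S hS
  have hnB : nB ≤ n := le_trans ((le_max_left _ _).trans (le_max_left _ _)) hn
  have hnT : nT ≤ n := le_trans ((le_max_right _ _).trans (le_max_left _ _)) hn
  have hn128 : 128 ≤ n := le_trans (le_max_right _ _) hn
  -- the S-box and the dictionary
  set f : QReg n → QReg n := fun x => fun j : Fin n => (g ^ Nat.ofBits x % p).testBit (j : ℕ) with hf
  rw [dlog_indicator_eq_graph n p g hp.pos hpn]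
  have hD : ∀ a : QReg n, a ≠ (fun _ => false) → ∀ b : QReg n,
      ((Finset.univ.filter fun x : QReg n =>
          (fun i => Bool.xor (f (fun j => Bool.xor (x j) (a j)) i) (f x i)) = b).card : ℝ)
        ≤ (2 : ℝ) ^ ((1 - δ) * (n : ℝ)) := fun a ha b =>
    (hB n hnB p g hp hpn hwin hg hguard a ha b).trans (hmono n hδB')
  have hΛ : ∀ β : QReg n, β ≠ (fun _ => false) → ∀ α : QReg n,
      |∑ x : QReg n, (∏ i, (if α i && x i then (-1 : ℝ) else 1)) *
          (∏ i, (if β i && f x i then (-1 : ℝ) else 1))| ≤ (2 : ℝ) ^ ((1 - δ) * (n : ℝ)) := by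
    intro β hβ α
    by_cases hα : α = fun _ => false
    · subst hα
      have hrange := stub_dlogWalshRange n p g hp hpn hwin hg β hβ
      simp only [Bool.false_and, Bool.false_eq_true, if_false, Finset.prod_const_one, one_mul]
      exact hrange.trans (range_numerics n hn128 δ hδ64)
    · exact (hT n hnT p g hp hpn hwin hg hguard β hβ α hα).trans (hmono n hδT')
  have main := GraphStateSpectrum_proof n f _ _ hD hΛ S hS
  rwa [max_self] at main

/-- **Composition of line `Sketch`** (skeleton v9): the crux from the registered stubs through
`dlogGraphFlat_of_dcb`. -/
theorem DlogGraphFlat_of :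
    Summit.QuantumAdvantage.QuantumAdvantage.Theses.SymplecticPurity.DlogGraphFlat :=
  dlogGraphFlat_of_dcb dcb_of_pair_quad

end Summit.QuantumAdvantage.QuantumAdvantage.Theorems.SymplecticPurity
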